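import Summits.QuantumFields.YangMills.Theorems.BalabanUVNodesN12AtTheta13OfThm1CCMWGenericDoorWindowGuard
import Summits.QuantumFields.YangMills.Theorems.BalabanUVNodesN12AtRecord13Prop1KnitThm1OfRecord
import Summits.QuantumFields.YangMills.Theorems.BalabanUVNodesN12Prop1DirectOfClassWindowUniformExplicit

/-!
# BalabanUVNodes ∕ N12 — «12X-W-DIRECT v7»: the WINDOW-GUARDED N12 socket at a door below `e⁻³`, every layer letter an object of record, Prop. 1 ON THE DIRECT ROAD, keyed on `(vii)_direct` = (E1)‴ `N12Prop1DirectOfClassWindowUniformExplicit`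
# (the lane's (P2c)′ explicit-threshold endpoint ∘ (D1)′ (P4)′ letter ∘ dag-n12-w6 g7's k-UNIFORM WINDOW-LOCAL (σ)_W producer ∘ dag-n12-c g21's class producers for the plaquette letters):
# NO (σ)-letter, NO plaquette letter, NO (P4)′ socket, NO topological hypothesis, NO `∃ δ₀` — EXPLICIT threshold per run, and under it ONE numeric row: the k-free floor `C(d,L)·εreg + m′·ρn ≤ δ`

Cell `pub-ymgap` (HUMAN RULINGS D-0062 ∕ D-0149), seat `pub-ymgap-dag-n12-d` g20 (R134 N12 [B15] s2; pen (P3) of plan g87 YMPLAN-G87-N12-ROAD, re-keyed on the LOCATED-FLOOR repair chain of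
2026-08-28 — lane ruling dag-n12-c g21 INBOX l.43385∕l.43484: (P2c)′ by the lane, (D1)′∕(E1)′∕this knit by this seat); count-neutral helper of K1⁹ `stmt-QuantumFields-27364` (`--kind proof --supports … --as helper`).  THEOREMS ONLY (0 `def`, 0 `instance`, 0 `sorry`); composition BY NAME.

WHAT.  «12X-W-DIRECT» (p658037) displayed the (WD) window∕direct letter package whole; «v2» keyed on (P2c) (p662019), «v3» on `(iv)_direct` (p664306), «v4» (p672229) on `(iv)_direct′`
(p671908).  All of those carried (P2c)'s frame `∃ δ₀ > 0, ∀ δ ≤ δ₀, ∀ (letters at δ), …` — harmless while the thresholded rows are LETTERS, but VACUOUS BY SHAPE the moment a producer turns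
a letter into a numeric floor (dag-n12-c g21's LOCATED-FLOOR, kernel certificate `B15Prop1NumericsThresholds.exists_threshold_frame_of_pos_floor`).  THIS edition keys on the repaired chain:
the lane's (P2c)′ `N12Prop1DirectOfChartHalfExplicit.…` (chart-half constants `C ρ Kτ ρτ` as binders + the uniform chart-half letter `hhalf`; threshold CLOSED-FORM; `hsm` by §7
`hsm_direct_of_le_explicitThreshold`) ∘ this seat's (D1)′ `N12Prop1DirectOfChartHalfOfRightInverseExplicit.…` ((P4)′ socket replaced by dag-n12-w6 g6's right-inverse letter `hHB` at displayed
constants `εH B`, tower-box plaquette letter `hPbox`, `hk1`) ∘ this seat's (E1)‴ `N12Prop1DirectOfClassWindowUniformExplicit.…` ((σ)_W discharged by dag-n12-w6 g7's k-UNIFORM window-LOCAL producer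
`N12WindowGaugeLetterUniformSocket.hσW_on_uniform_of_class` p675589 — general `Z`, no letter off the window, graded [15] Thm 1 letter read off the class at level `k−1`; the plaquette letter
`hPχ` and the tower-box plaquette letter `hPbox` discharged by dag-n12-c g21's `B15Prop1PlaquetteLettersOfClass.hPχ_on_of_class` ∕ `hPbox_on_of_class` p675521 — what remains under the
threshold is ONE numeric row, the producer's k-FREE tolerance FLOOR; sibling «v6» p675699 ∕ p675722 keys on (E1)′ p675361 with the first, k-growing floor and the plaquette letters displayed).  Hence the statement, per run `P`: all
tolerance-free rows as binders ((J0′)@eR + `h𝓐₀`, region boxes + `ρn hρn`, `Kb`, `γ₈ cJ bx`, dag-n12-w4's geometry letter `hΩw`, the window `W` + `hWbox`, the k-uniform producer's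
numerics `c hkc hc`, class rows `hεreg hα3 hα2 haN`, window rows `X D₀ hXΩ hfit hBox hWX hfeedsX` (window within walk-distance `D₀` of `Ω_k(Z)`, collar fit inside `L^{k−1}·M₁`), the radius row `hrad`, the chart half `C ρ Kτ ρτ hρ hKτ hρτ` + letter `hhalf`, the (P4)′ constants `εH B` + letter `hHB`,
(P5) `M₂ hM₂0 hM₂`, the small-below letter `hsb`, `hγle` at `γ₀ = 1∕2`, geometry, `cE cA` rows, `h15`), then
`∀ δ, (∀ P i, 0 < δ P i) → (∀ P i, δ P i ≤ min (Θ P i) (εH P i)) → ∀ (hfloor), ∃ γ₁₂ > 0, ∃ lamW, ∀ P, lamW.kSel P < P.K → Step.InInterval γ₁₂ P.K (gOfRecord₁₃ F 2 θW P) → B15Leaf (WOfRecord₁₃ F 2 θW lamW P)` at the door `θ₁₅ᶜᶜᴹᵂ(j;γ;ε₀,ε₂₉;B₃,B₃',a₀,a₁)` (door letters and per-in-window-run layer letters as in every 12X-W edition; `0 < εreg` fed by the door's `ha₀`) with `Θ P i` SPELLED OUT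
(`min (min ρ ρτ ∕ 2) (min 1 (rhs ∕ (max S 0 + 1)))` at `Kc := 12𝓐₀∕R·√#{b ∕∕ b.src ∈ Ω₁(Z)}`, `Cμ := 2(d−1)√#PBond·B·M₂`, `Cτ := 16(d+1)(Kτ+1) + 8d·#box·(C·Kc)²`, `rhs := (1∕2)∕(2(3Kb²+2Kb⁴))`)
and ONE tolerance row at `δ P i`: the producer's k-FREE FLOOR `hfloor` (`(((4d+m′+3)²L²∕4) + m′·24(((d+2)L)²∕4))·εreg + m′·ρn P i ≤ δ P i` — a checkable smallness condition on the
record's class threshold `εreg` and the datum tolerance, uniform in the height; it implies `εreg ≤ δ P i`, the class producers' tolerance condition) — NO letter about the minimiser under the threshold.  Generated by the seat's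
explicit-frame re-keyer (`lean/g20/mk_knit_expl.py spec_dir7.json`).

HONEST FRAMING ∕ LOCATED.  Bookkeeping by name over landed modules; NO (σ)-letter and NO scope line remain (the k-uniform window-LOCAL producer has no hypothesis off the window; its floor constant `C(d,L)` is explicit and k-free — still NOT print's per-level
`O(1)` bookkeeping of [15] (16)–(18)); the small-below letter `hsb` is global on the torus (LOCATED-HSB, the lane's ρ5 proxy programme); the thresholds are per-instance and volume-DEPENDENT (√#bonds, #box displayed); the chart-half and
right-inverse letters, the window rows, the numerics, the small-below letter `hPχ` ∕ `hPbox`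
((P4)′ itself is DISCHARGED — the producer's `ε`, `B` are per-height ∕ per-instance EXISTENCE constants, print's volume-uniform (46)∕(83) NOT claimed), (P5), (J0′), [15] Thm 1, the geometry, K0b's residuals and N12's per-run rows below the torus stay LETTERS; per-instance constants; NO topological hypothesis on `Ω₁(Z)`;
nothing of Bałaban's asserted; N12 NOT discharged; K0⁷ ∕ K1⁹ NOT closed; counts unmoved; one finite 𝕋⁴ programme at fixed `ε = L^{-K}` — R4 closes only the conditional rung
`BalabanLadder.UV`; no summit statement is proved here and NOT the Yang–Mills mass gap (Clay); nothing continuum ∕ ℝ⁴ ∕ OS.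

References: [Balaban1989LargeFieldI] CMP 122 (1989) 175–202; [Balaban1989LargeFieldII] CMP 122 (1989) 355–392; [Balaban1988Convergent] CMP 119 (1988) 243–285; [Balaban1985Averaging] CMP 98 (1985) 17–51;
[Balaban1985Variational] CMP 102 (1985) 277–309; [Balaban1987RG1] CMP 109 (1987) 249–301 (locators in the theorem docstring).
-/

noncomputable section
open MeasureTheory Set Finset Metric Filter
open scoped Matrix.Norms.L2Operator BigOperators Matrix RealInnerProductSpace Real InnerProductSpace Topology

namespace Summit.QuantumFields.YangMills.BalabanUVNodes.N12AtTheta13OfThm1CCMWGenericDoorWindowGuardPinLFWindowDirectOfClassWindowUniformExplicit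

open Literature.MathematicalPhysics.QuantumFieldTheory.Balaban1983to89
open Literature.MathematicalPhysics.QuantumFieldTheory.Balaban1983to89.T4Continuum (T4Family LStep Letter walk walkEnd netDisp holAt)
open Literature.MathematicalPhysics.QuantumFieldTheory.Balaban1983to89.DagBinding
open Literature.MathematicalPhysics.QuantumFieldTheory.Balaban1983to89.Node00
open FlowStep (prefixOf BetaLowerH BetaUpperH)
open B15Claim189Assembly (Setting189 new189 chiPP dom half)
open B15 (Prop1Printed Ineq180)
open B15.BasicStep (Claim189)
open B15.PrelimIntegrations (Ineq191 Ineq195)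
open B15Chi124DetSets (E124)
open B14DomainGeom (Pt)
open B8Eq17ClassAkV1 (plaqsOf)
open B14.Eq216Concrete (inputs feeds)
open GaugeGroup (dist1)
open GaugeField (plaqHol gaugeAct)
open B15Claim189PrintedConditions (omegaOfChain)
open B15Claim189PinsOfHistory (N0OfRecord₁₃)
open B15Claim189LambdaPin (enlD)
open B15RPrime1100OfRep (rPrimeDataOfSel)
open Summit.QuantumFields.YangMills.BalabanUVNodes.N12AtRecord13Prop1KnitThm1OfRecord (thm1TorusClass_of_variationalThm1RegSepCoP7M)
open Summit.QuantumFields.YangMills.BalabanUVNodes.N12AtTheta13OfThm1CCMWGenericDoorWindowGuard (exists_gamma_residW_b15Leaf_window_theta13OfThm1CCMW_topLevel_pinnedΛΩχZ_of_massLive)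
open T4CubeChartGnomonic (SU2)
open B15Prop1ChartSU2 (su2Chart)
open B15Prop1SliceCoordinates (GaugeSlice ιA)
open T4AxialGaugeSmallField (castSite boxPlaqs boxBonds)
open B6BondElimination (unitVec)
open B6TreeGaugePoincare (curl)
open B16Eq18Proof (box)
open B15Extension193 (extend)
open B15ShellGauge193 (shellGauge)
open B15Sect1Instances (fun177std)
open B14.Eq213DetSet (Bj maxDomT)
open B14.Eq213MaximalDomains (side)
open B14.Eq22Determines (blockIter IsBlockUnion)
open Literature.MathematicalPhysics.QuantumFieldTheory.BalabanImbrieJaffe1984to88.BIJ85Eq453GaugeField (qsstarGIter0)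
open B16Sect1Backgrounds (expMul toMS)
open B15DeterminingSets (pts DetBackground genSet IsMinimizer MSField avgFamily bondsOf DetSet embIter AgreeOn)
open B5Eq118OneStroke (iterBlockOf)
open B15Eq112TorusCover (lift)
open ExpMeanLog (deltaSU)
open B15Prop1Carrier (lfVarOn InstOn InstOn.std plaqsInside)
open Summit.QuantumFields.YangMills.BalabanUVNodes.N12Prop1DirectOfClassWindowUniformExplicit (exists_domain_prop1Printed_lfVarOn_std_su2_box_intrinsic_analytic_atZSeqCoPRecord_ofThm1TorusClass_ofMinimiserFamily_ofClassLetters_ofWindowGaugeUniform_ofChartHalfLetter_ofRightInverseLetter_explicit)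
open T4AdjointCovarianceUnitary (lieSU)
open B15Prop1GradientFromNearValueAtCoPRecord (far_letter_of_box)
open B15Prop1AnalyticExtClause (cplxVec anExt)
open B15Prop1ChartCalculusSU2 (E3)

variable {F : T4Family}

/-! ## §2 «12X-W-DIRECT v7» AT THE GENERIC DOOR-CURED WINDOW-EDITION WITNESS, DOOR BELOW `e⁻³`: the window-guarded socket from `(vii)_direct` (E1)‴ (explicit threshold; (P4)′ letter; k-UNIFORM window gauge and plaquette letters from the class), no `∃ δ₀` -/

section WindowRoadPinLF
variable {j : ℕ} {γ ε₀ ε₂₉ B₃ B₃' a₀ a₁ : ℝ} (lam : ResidW F 2) (σ : ∀ P : B12.RunParams, Sit189 F 2 P.K)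
  (s : ∀ P : B12.RunParams, SeqOfRecord F (theta13OfThm1CCMW F 2 j γ ε₀ ε₂₉ B₃ B₃' a₀ a₁).ν (theta13OfThm1CCMW F 2 j γ ε₀ ε₂₉ B₃ B₃' a₀ a₁).τ9.M (gOfRecord₁₃ F 2 (theta13OfThm1CCMW F 2 j γ ε₀ ε₂₉ B₃ B₃' a₀ a₁) P) P.K (P.K - 1 + 1)) (Nm : B12.RunParams → ℕ) (p₁ : ℕ)

/-- **★★★ THE WINDOW-GUARDED N12 SOCKET AT A DOOR BELOW `e⁻³`, EVERY LETTER OF THE LAYER AN OBJECT OF RECORD, PROP. 1 ON THE DIRECT ROAD FROM THE ASSEMBLED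
ENDPOINT (P2c), THRESHOLD FRAME** — for every `δ` below the endpoint's EXPLICIT threshold and the
ONE per-run tolerance row `hfloor`, the endpoint (E1)‴ `N12Prop1DirectOfClassWindowUniformExplicit.…` per run and 12Zᴳ-W §2 give the window-edition witness (`0 < εreg` fed by the door's `ha₀`).  Displayed: see the module docstring. [cite: Balaban1989LargeFieldI, (0.1)–(0.6) pp.175–176, (1.2) p.178, (1.74) p.192, Prop. 1 (1.77)–(1.78) p.194 («for ε > 0 sufficiently small»), (1.79)–(1.80) p.195, (1.89) p.198, (1.91)–(1.97) pp.198–199, (1.99)–(1.102) pp.200–201; Balaban1989LargeFieldII, p.357, (1.7)–(1.13) pp.358–359, (1.17)–(1.19) pp.360–361; Balaban1988Convergent, (2.1)–(2.9) pp.254–256, (2.17)–(2.18) p.257, (3.16)–(3.25) pp.268–270; Balaban1985Variational, Thm 1 (8) p.279, (16)–(18) p.280, (44)–(47) p.285, (83) p.290; Balaban1985Averaging, Prop. 2 (52)–(53) p.26; Balaban1987RG1, Thm 1 p.259, (0.20) p.256] -/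
theorem exists_gamma_residW_b15Leaf_window_theta13OfThm1CCMW_pinLF_pinnedΛΩχZ_of_massLive_windowDirectOfClassWindowUniformExplicit
    (hγ₀ : 0 < γ) (hγh : γ ≤ 1 / 2) (hB : 0 ≤ B₃) (hB' : 0 ≤ B₃') (ha₀ : 0 < a₀) (ha₁ : 0 < a₁)
    {β' : ℝ} (hbox' : BetaUpperH β' γ (betaOfRecord₁₃ F 2 (theta13OfThm1CCMW F 2 j γ ε₀ ε₂₉ B₃ B₃' a₀ a₁))) (hβ' : β' * γ ^ 2 ≤ 3 / 4) (hγe : γ ≤ Real.exp (-3))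
    (D : ∀ P : B12.RunParams, Setting189 (F.P P.K) (SU 2) (MSField (F.P P.K) (SU 2) × ((j : ℕ) → VecField (F.P P.K) j (EuclideanSpace ℝ (Fin (2 ^ 2 - 1))))) (Pt (F.P P.K).d))
    (hD : ∀ P : B12.RunParams, D P = ((({ lam with kSel := fun P : B12.RunParams => P.K - 1, D1100 := fun P : B12.RunParams => rPrimeDataOfSel (reprTOfRecord₁₃ F 2 (theta13OfThm1CCMW F 2 j γ ε₀ ε₂₉ B₃ B₃' a₀ a₁) P (P.K - 1)) ((theta13OfThm1CCMW F 2 j γ ε₀ ε₂₉ B₃ B₃' a₀ a₁).ppSel P (gOfRecord₁₃ F 2 (theta13OfThm1CCMW F 2 j γ ε₀ ε₂₉ B₃ B₃' a₀ a₁) P) (P.K - 1 + 1)) (fibOfSeq F (theta13OfThm1CCMW F 2 j γ ε₀ ε₂₉ B₃ B₃' a₀ a₁).ν (theta13OfThm1CCMW F 2 j γ ε₀ ε₂₉ B₃ B₃' a₀ a₁).τ9 P (gOfRecord₁₃ F 2 (theta13OfThm1CCMW F 2 j γ ε₀ ε₂₉ B₃ B₃' a₀ a₁) P) (P.K - 1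 + 1)) } : ResidW F 2).pinRPrime₁₃ (theta13OfThm1CCMW F 2 j γ ε₀ ε₂₉ B₃ B₃' a₀ a₁)).pinD189ΛH (theta13OfThm1CCMW F 2 j γ ε₀ ε₂₉ B₃ B₃' a₀ a₁).ν (theta13OfThm1CCMW F 2 j γ ε₀ ε₂₉ B₃ B₃' a₀ a₁).A₁ (theta13OfThm1CCMW F 2 j γ ε₀ ε₂₉ B₃ B₃' a₀ a₁).τ9.M (gOfRecord₁₃ F 2 (theta13OfThm1CCMW F 2 j γ ε₀ ε₂₉ B₃ B₃' a₀ a₁)) (fun P => (((((σ P).pinZres (theta13OfThm1CCMW F 2 j γ ε₀ ε₂₉ B₃ B₃' a₀ a₁).ν (theta13OfThm1CCMW F 2 j γ ε₀ ε₂₉ B₃ B₃' a₀ a₁).τ9.M (gOfRecord₁₃ F 2 (theta13OfThm1CCMW F 2 j γ ε₀ ε₂₉ B₃ B₃' a₀ a₁) P) (s P) (N0OfRecord₁₃ (theta13OfThm1CCMW F 2 j γ ε₀ ε₂₉ B₃ B₃' a₀ a₁) P (P.K - 1 + 1))).pinSides (theta13OfThm1CCMW F 2 j γ ε₀ ε₂₉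 B₃ B₃' a₀ a₁).ν (gOfRecord₁₃ F 2 (theta13OfThm1CCMW F 2 j γ ε₀ ε₂₉ B₃ B₃' a₀ a₁) P) (P.K - 1 + 1 - Nm P) (P.K - 1 + 1)).pinXΩ4 (s P) (enlD F (theta13OfThm1CCMW F 2 j γ ε₀ ε₂₉ B₃ B₃' a₀ a₁).ν (theta13OfThm1CCMW F 2 j γ ε₀ ε₂₉ B₃ B₃' a₀ a₁).τ9.M P (gOfRecord₁₃ F 2 (theta13OfThm1CCMW F 2 j γ ε₀ ε₂₉ B₃ B₃' a₀ a₁) P))).pinOmegaPP (s P) (Nm P) (enlD F (theta13OfThm1CCMW F 2 j γ ε₀ ε₂₉ B₃ B₃' a₀ a₁).ν (theta13OfThm1CCMW F 2 j γ ε₀ ε₂₉ B₃ B₃' a₀ a₁).τ9.M P (gOfRecord₁₃ F 2 (theta13OfThm1CCMW F 2 j γ ε₀ ε₂₉ B₃ B₃' a₀ a₁) P)))) s Nm p₁).D189 P)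
    (hmassLive : ∀ P : B12.RunParams, 1 ≤ P.K → Step.InInterval γ P.K (gOfRecord₁₃ F 2 (theta13OfThm1CCMW F 2 j γ ε₀ ε₂₉ B₃ B₃' a₀ a₁) P) → ∀ a, LiveSeq F 2 (theta13OfThm1CCMW F 2 j γ ε₀ ε₂₉ B₃ B₃' a₀ a₁).ν (theta13OfThm1CCMW F 2 j γ ε₀ ε₂₉ B₃ B₃' a₀ a₁).τ9 P (gOfRecord₁₃ F 2 (theta13OfThm1CCMW F 2 j γ ε₀ ε₂₉ B₃ B₃' a₀ a₁) P) (P.K - 1 + 1)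
        (slotsTOfRecord F 2 (theta13OfThm1CCMW F 2 j γ ε₀ ε₂₉ B₃ B₃' a₀ a₁).ν (theta13OfThm1CCMW F 2 j γ ε₀ ε₂₉ B₃ B₃' a₀ a₁).τ9 (EOfRecord₁₃ F 2 (theta13OfThm1CCMW F 2 j γ ε₀ ε₂₉ B₃ B₃' a₀ a₁)) (wOfRecord₉ F 2 (theta13OfThm1CCMW F 2 j γ ε₀ ε₂₉ B₃ B₃' a₀ a₁).toStage9Params)
          (theta13OfThm1CCMW F 2 j γ ε₀ ε₂₉ B₃ B₃' a₀ a₁).ppSel P (gOfRecord₁₃ F 2 (theta13OfThm1CCMW F 2 j γ ε₀ ε₂₉ B₃ B₃' a₀ a₁) P) (P.K - 1 + 1)) a →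
      0 < ∫ V, rterm (reprTOfRecord₁₃ F 2 (theta13OfThm1CCMW F 2 j γ ε₀ ε₂₉ B₃ B₃' a₀ a₁) P (P.K - 1)) a V ∂(fieldMeasure (F.P P.K) (P.K - 1 + 1) (SU 2)))
    (hNN : ∀ P : B12.RunParams, 1 ≤ P.K → Step.InInterval γ P.K (gOfRecord₁₃ F 2 (theta13OfThm1CCMW F 2 j γ ε₀ ε₂₉ B₃ B₃' a₀ a₁) P) → N0OfRecord₁₃ (theta13OfThm1CCMW F 2 j γ ε₀ ε₂₉ B₃ B₃' a₀ a₁) P (P.K - 1 + 1) ≤ Nm P)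
    (hNk : ∀ P : B12.RunParams, 1 ≤ P.K → Step.InInterval γ P.K (gOfRecord₁₃ F 2 (theta13OfThm1CCMW F 2 j γ ε₀ ε₂₉ B₃ B₃' a₀ a₁) P) → N0OfRecord₁₃ (theta13OfThm1CCMW F 2 j γ ε₀ ε₂₉ B₃ B₃' a₀ a₁) P (P.K - 1 + 1) ≤ P.K - 1 + 1)
    (hβ0 : ∀ P : B12.RunParams, 1 ≤ P.K → Step.InInterval γ P.K (gOfRecord₁₃ F 2 (theta13OfThm1CCMW F 2 j γ ε₀ ε₂₉ B₃ B₃' a₀ a₁) P) → 0 ≤ (σ P).β)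
    (hβ : ∀ P : B12.RunParams, 1 ≤ P.K → Step.InInterval γ P.K (gOfRecord₁₃ F 2 (theta13OfThm1CCMW F 2 j γ ε₀ ε₂₉ B₃ B₃' a₀ a₁) P) → (σ P).β ≤ 1 / 4)
    (hL₀ : ∀ P : B12.RunParams, 1 ≤ P.K → Step.InInterval γ P.K (gOfRecord₁₃ F 2 (theta13OfThm1CCMW F 2 j γ ε₀ ε₂₉ B₃ B₃' a₀ a₁) P) → 2 ≤ (σ P).L₀)
    (hL₀L : ∀ P : B12.RunParams, 1 ≤ P.K → Step.InInterval γ P.K (gOfRecord₁₃ F 2 (theta13OfThm1CCMW F 2 j γ ε₀ ε₂₉ B₃ B₃' a₀ a₁) P) → (σ P).L₀ ^ 2 ≤ ((F.P P.K).L : ℝ))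
    (hOB : ∀ P : B12.RunParams, 1 ≤ P.K → Step.InInterval γ P.K (gOfRecord₁₃ F 2 (theta13OfThm1CCMW F 2 j γ ε₀ ε₂₉ B₃ B₃' a₀ a₁) P) → 0 ≤ (σ P).O1 * (σ P).B₃ * (σ P).B₅)
    (hδ : ∀ P : B12.RunParams, 1 ≤ P.K → Step.InInterval γ P.K (gOfRecord₁₃ F 2 (theta13OfThm1CCMW F 2 j γ ε₀ ε₂₉ B₃ B₃' a₀ a₁) P) → 0 ≤ (σ P).δ)
    (hC : ∀ P : B12.RunParams, 1 ≤ P.K → Step.InInterval γ P.K (gOfRecord₁₃ F 2 (theta13OfThm1CCMW F 2 j γ ε₀ ε₂₉ B₃ B₃' a₀ a₁) P) →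
      4 * (2 + (121 / 120) ^ 2 * ((σ P).O1 * (σ P).B₃ * (σ P).B₅ * ((theta13OfThm1CCMW F 2 j γ ε₀ ε₂₉ B₃ B₃' a₀ a₁).τ9.M : ℝ) ^ 5)) ≤ (Real.log (γ ^ 2)⁻¹) ^ (Real.log ((σ P).L₀ ^ 2) / Real.log ((F.P P.K).L : ℝ)))
    (hβhist : ∀ P : B12.RunParams, 1 ≤ P.K → Step.InInterval γ P.K (gOfRecord₁₃ F 2 (theta13OfThm1CCMW F 2 j γ ε₀ ε₂₉ B₃ B₃' a₀ a₁) P) → ∀ i, i < P.K - 1 + 1 → 0 ≤ betaOfRecord₁₃ F 2 (theta13OfThm1CCMW F 2 j γ ε₀ ε₂₉ B₃ B₃' a₀ a₁) i (prefixOf (gOfRecord₁₃ F 2 (theta13OfThm1CCMW F 2 j γ ε₀ ε₂₉ B₃ B₃' a₀ a₁) P) i))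
    (hMl : ∀ P : B12.RunParams, 1 ≤ P.K → Step.InInterval γ P.K (gOfRecord₁₃ F 2 (theta13OfThm1CCMW F 2 j γ ε₀ ε₂₉ B₃ B₃' a₀ a₁) P) → (121 / 120) ^ 2 * ((σ P).O1 * (σ P).B₃ * (σ P).B₅ * ((theta13OfThm1CCMW F 2 j γ ε₀ ε₂₉ B₃ B₃' a₀ a₁).τ9.M : ℝ) ^ 5) * Real.exp (-(4 * (σ P).δ * ((theta13OfThm1CCMW F 2 j γ ε₀ ε₂₉ B₃ B₃' a₀ a₁).τ9.M : ℝ))) ≤ 1 / 12)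
    (hΛ : ∀ P : B12.RunParams, 1 ≤ P.K → Step.InInterval γ P.K (gOfRecord₁₃ F 2 (theta13OfThm1CCMW F 2 j γ ε₀ ε₂₉ B₃ B₃' a₀ a₁) P) → (((enlD F (theta13OfThm1CCMW F 2 j γ ε₀ ε₂₉ B₃ B₃' a₀ a₁).ν (theta13OfThm1CCMW F 2 j γ ε₀ ε₂₉ B₃ B₃' a₀ a₁).τ9.M P (gOfRecord₁₃ F 2 (theta13OfThm1CCMW F 2 j γ ε₀ ε₂₉ B₃ B₃' a₀ a₁) P)) 4 (P.K - 1 + 1 + 1 - (N0OfRecord₁₃ (theta13OfThm1CCMW F 2 j γ ε₀ ε₂₉ B₃ B₃' a₀ a₁) P (P.K - 1 + 1)))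
        (omegaOfChain (s P) (P.K - 1 + 1 + 1 - (N0OfRecord₁₃ (theta13OfThm1CCMW F 2 j γ ε₀ ε₂₉ B₃ B₃' a₀ a₁) P (P.K - 1 + 1)))))ᶜ ∩ (σ P).Z).Nonempty)
    (L91h : ∀ P : B12.RunParams, 1 ≤ P.K → Step.InInterval γ P.K (gOfRecord₁₃ F 2 (theta13OfThm1CCMW F 2 j γ ε₀ ε₂₉ B₃ B₃' a₀ a₁) P) → ∀ U, new189 (D P) U → ∀ p ∈ plaqsOf (half (D P)),
      Ineq191 (dist1 (plaqHol ((D P).Upp U) p)) ((D P).devV'' U p) (D P).α (((D P).L ^ (D P).h)⁻¹) ((D P).ε (D P).h) (E124 (D P).ε (D P).L (D P).η (D P).k (D P).h))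
    (L95 : ∀ P : B12.RunParams, 1 ≤ P.K → Step.InInterval γ P.K (gOfRecord₁₃ F 2 (theta13OfThm1CCMW F 2 j γ ε₀ ε₂₉ B₃ B₃' a₀ a₁) P) → ∀ U, new189 (D P) U → ∀ p ∈ plaqsOf (half (D P)),
      Ineq195 ((D P).devV'' U p) (dist1 (plaqHol ((D P).Uhalf U ((D P).boxOf p)) p)) (D P).α (((D P).L ^ (D P).h)⁻¹) ((D P).ε (D P).h) (E124 (D P).ε (D P).L (D P).η (D P).k (D P).h))
    (L91 : ∀ P : B12.RunParams, 1 ≤ P.K → Step.InInterval γ P.K (gOfRecord₁₃ F 2 (theta13OfThm1CCMW F 2 j γ ε₀ ε₂₉ B₃ B₃' a₀ a₁) P) → ∀ U, new189 (D P) U → ∀ i, (D P).h ≤ i → i ≤ (D P).k → ∀ p ∈ plaqsOf (dom (D P) i),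
      Ineq191 (dist1 (plaqHol ((D P).Upp U) p)) ((D P).dev97 U p) (D P).α (((D P).L ^ i)⁻¹) ((D P).ε i) (E124 (D P).ε (D P).L (D P).η (D P).k i))
    (L97 : ∀ P : B12.RunParams, 1 ≤ P.K → Step.InInterval γ P.K (gOfRecord₁₃ F 2 (theta13OfThm1CCMW F 2 j γ ε₀ ε₂₉ B₃ B₃' a₀ a₁) P) → ∀ U, new189 (D P) U → ∀ i, (D P).h ≤ i → i ≤ (D P).k → ∀ p ∈ plaqsOf (dom (D P) i),
      Ineq191 ((D P).dev97 U p) ((D P).dev0 U p) (D P).α (((D P).L ^ i)⁻¹) ((D P).ε i) (E124 (D P).ε (D P).L (D P).η (D P).k i))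
    (L80 : ∀ P : B12.RunParams, 1 ≤ P.K → Step.InInterval γ P.K (gOfRecord₁₃ F 2 (theta13OfThm1CCMW F 2 j γ ε₀ ε₂₉ B₃ B₃' a₀ a₁) P) → ∀ U, new189 (D P) U → ∀ i, (D P).h ≤ i → i ≤ (D P).k → ∀ p ∈ plaqsOf (dom (D P) i),
      Ineq180 ((D P).dev0 U p) ((D P).ε (D P).k) (D P).η (D P).B₃ (D P).B₅ (D P).M (D P).δ ((D P).dist p) (D P).O1)
    -- dag-n12-w5's endpoint `N12Prop1DirectOfClassWindowUniformExplicit` ON THE RUN's LATTICE, per run `P` and instance family `ι P` (every letter of the endpoint displayed per run;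
    -- `hfar` from the knit's box letter `hZ1` by `far_letter_of_box`, the [15] torus-class letter from `h15` by `thm1TorusClass_of_variationalThm1RegSepCoP7M`)
    (hd3 : ∀ P : B12.RunParams, 3 ≤ (F.P P.K).d) (h0 : ∀ P : B12.RunParams, 0 < (F.P P.K).d) (ι : B12.RunParams → Type)
    (Z Λ : ∀ P : B12.RunParams, ι P → Set (Site (F.P P.K) 0)) (k : ∀ P : B12.RunParams, ι P → ℕ) (M : ∀ P : B12.RunParams, ι P → ℝ) (hk0 : ∀ (P : B12.RunParams) (i : ι P), 0 < k P i) (hk1 : ∀ (P : B12.RunParams) (i : ι P), k P i + 1 ≤ (F.P P.K).m + (F.P P.K).K)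
    (eR : ∀ P : B12.RunParams, ι P → ℝ) (heR : ∀ (P : B12.RunParams) (i : ι P), 0 < eR P i)
    (T : ∀ (P : B12.RunParams) (i : ι P), Finset (PBond (F.P P.K) (k P i)))
    (lo hi : ∀ P : B12.RunParams, ι P → Fin (F.P P.K).d → ℤ) (n : ∀ P : B12.RunParams, ι P → ℕ) (hn : ∀ (P : B12.RunParams) (i : ι P) κ, hi P i κ ≤ lo P i κ + n P i) (hN : ∀ (P : B12.RunParams) (i : ι P), n P i + 2 < (F.P P.K).sitesPerDir (k P i))
    (hbox : ∀ (P : B12.RunParams) (i : ι P), pts (k P i) (Λ P i) = (castSite '' Set.Icc (lo P i) (hi P i) : Set (Site (F.P P.K) (k P i))))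
    (hZ : ∀ (P : B12.RunParams) (i : ι P), (boxPlaqs (lo P i - 1) (hi P i + 1) : Set (Plaq (F.P P.K) (k P i))) ⊆ plaqsInside (pts (k P i) (Z P i)))
    (hTG0 : ∀ (P : B12.RunParams) (i : ι P), T P i = (box (fun κ => (hi P i κ - lo P i κ + 1).toNat) (lo P i)).image fun x =>
      (⟨castSite (x - unitVec ⟨0, h0 P⟩), ⟨0, h0 P⟩⟩ : PBond (F.P P.K) (k P i)))
    (hN5 : ∀ (P : B12.RunParams) (i : ι P) κ, ((hi P i κ - lo P i κ + 1).toNat : ℤ) + 5 < (F.P P.K).sitesPerDir (k P i))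
    (Kb : ∀ P : B12.RunParams, ι P → ℕ) (hK1 : ∀ (P : B12.RunParams) (i : ι P), 1 ≤ Kb P i) (hKn : ∀ (P : B12.RunParams) (i : ι P) κ, (hi P i κ - lo P i κ + 1).toNat ≤ Kb P i)
    (ext : ∀ (P : B12.RunParams) (i : ι P), GaugeField (F.P P.K) (k P i) SU2 → GaugeField (F.P P.K) (k P i) SU2)
    (hext : ∀ (P : B12.RunParams) (i : ι P) Vk, ext P i Vk = extend (pts (k P i) (Λ P i)) (shellGauge Vk (lo P i) (hi P i)) Vk)
    (hlohi : ∀ (P : B12.RunParams) (i : ι P), lo P i ≤ hi P i)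
    -- the REGION parallelepipeds of the normalisation and the datum tolerances
    (LO HI : ∀ P : B12.RunParams, ι P → Fin (F.P P.K).d → ℤ) (hLO : ∀ (P : B12.RunParams) (i : ι P), LO P i ≤ lo P i - 1) (hHI : ∀ (P : B12.RunParams) (i : ι P), hi P i + 1 ≤ HI P i) (n' : ∀ P : B12.RunParams, ι P → ℕ) (hn' : ∀ (P : B12.RunParams) (i : ι P) κ, HI P i κ ≤ LO P i κ + n' P i)
    (hn'N : ∀ (P : B12.RunParams) (i : ι P), n' P i < (F.P P.K).sitesPerDir (k P i)) (hR' : ∀ (P : B12.RunParams) (i : ι P), (boxPlaqs (LO P i) (HI P i) : Set (Plaq (F.P P.K) (k P i))) ⊆ plaqsInside (pts (k P i) (Z P i)))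
    (ρn : ∀ P : B12.RunParams, ι P → ℝ)
    (hρn : ∀ (P : B12.RunParams) (i : ι P), (((F.P P.K).d : ℝ) * n' P i + 1) * ((((F.P P.K).d - 1 : ℕ) : ℝ) * n' P i * ((12 * (F.P P.K).d * (n P i + 2) ^ 2 + 1) * eR P i)
      + 3 * (F.P P.K).d * (n P i + 2) ^ 2 * eR P i) ≤ ρn P i)
    {γ₈ cJ bx : B12.RunParams → ℝ} (hγ : ∀ P : B12.RunParams, 0 < γ₈ P) (hcJ : ∀ P : B12.RunParams, 0 ≤ cJ P) (hbx : ∀ P : B12.RunParams, 0 ≤ bx P)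
    (hbxM : ∀ (P : B12.RunParams) (i : ι P), 12 * ((F.P P.K).d : ℝ) * ((n P i : ℝ) + 2) ^ 2 ≤ bx P * (M P i) ^ 2)
    {R 𝓐₀ : ∀ P : B12.RunParams, ι P → ℝ} (hM : ∀ (P : B12.RunParams) (i : ι P), 1 ≤ (M P i)) (hR : ∀ (P : B12.RunParams) (i : ι P), 0 < R P i) (h𝓐₀ : ∀ (P : B12.RunParams) (i : ι P), 0 ≤ 𝓐₀ P i)
    -- (J0′), R-EXPLICIT: per instance one radius and one bound for every base field of the strict guard
    (hMin : ∀ (P : B12.RunParams) (i : ι P) Vk, PlaqSmallOn (plaqsInside (pts (k P i) (Z P i ∩ (Λ P i)ᶜ))) (eR P i) Vk →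
      ∃ Ũ : VecField (F.P P.K) (k P i) (EuclideanSpace ℂ (Fin 3)) × VecField (F.P P.K) (k P i) (EuclideanSpace ℂ (Fin 3)) →
          PBond (F.P P.K) 0 → Matrix (Fin 2) (Fin 2) ℂ,
        (∀ b a c, DifferentiableOn ℂ (fun z => Ũ z b a c) (ball 0 (R P i))) ∧
        (∀ z ∈ ball (0 : VecField (F.P P.K) (k P i) (EuclideanSpace ℂ (Fin 3)) × VecField (F.P P.K) (k P i) (EuclideanSpace ℂ (Fin 3))) (R P i),
          ∀ b a c, ‖Ũ z b a c‖ ≤ 𝓐₀ P i) ∧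
        ∀ p B' : VecField (F.P P.K) (k P i) E3, ‖p‖ < R P i → ‖B'‖ < R P i → ∃ U' : GaugeField (F.P P.K) 0 SU2,
          (∀ b, Ũ (cplxVec p, cplxVec B') b = ((U' b : SU2) : Matrix (Fin 2) (Fin 2) ℂ)) ∧
            IsMinimizer (Node00.avOfRecord F 2 P.K) (Node00.regMSCoPOfRecord F 2 (theta13OfThm1CCMW F 2 j γ ε₀ ε₂₉ B₃ B₃' a₀ a₁).ν P.K (k P i) (maxDomT (theta13OfThm1CCMW F 2 j γ ε₀ ε₂₉ B₃ B₃' a₀ a₁).ν.M₁ (Z P i))) (Bj (theta13OfThm1CCMW F 2 j γ ε₀ ε₂₉ B₃ B₃' a₀ a₁).ν.M₁ (Z P i) (k P i))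
              (avgFamily (Node00.avOfRecord F 2 P.K) (qsstarGIter0 (k P i) (expMul su2Chart B' (ext P i (expMul su2Chart p Vk))))) U')
    -- dag-n12-w4's GEOMETRY letter of the chart file (the window box and its two shifts inside `Ω_k(Z)`)
    (hΩw : ∀ (P : B12.RunParams) (i : ι P), ∀ (ν' : Fin (F.P P.K).d), ∀ z ∈ box (fun κ => (hi P i κ - lo P i κ + 1).toNat + 3) (fun κ => lo P i κ - 2),
      (castSite z : Site (F.P P.K) (k P i)) ∈ pts (k P i) (maxDomT (theta13OfThm1CCMW F 2 j γ ε₀ ε₂₉ B₃ B₃' a₀ a₁).ν.M₁ (Z P i) (k P i)) ∧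
        (castSite z : Site (F.P P.K) (k P i)).shift ⟨0, h0 P⟩ ∈ pts (k P i) (maxDomT (theta13OfThm1CCMW F 2 j γ ε₀ ε₂₉ B₃ B₃' a₀ a₁).ν.M₁ (Z P i) (k P i)) ∧
        (castSite z : Site (F.P P.K) (k P i)).shift ν' ∈ pts (k P i) (maxDomT (theta13OfThm1CCMW F 2 j γ ε₀ ε₂₉ B₃ B₃' a₀ a₁).ν.M₁ (Z P i) (k P i)))
    -- the WINDOW per instance, containing every plaquette whose source lies in the fine image of the enlarged window box (the chart half's `hW`)
    (W : ∀ P : B12.RunParams, ι P → Finset (Plaq (F.P P.K) 0))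
    (hWbox : ∀ (P : B12.RunParams) (i : ι P), ∀ q : Plaq (F.P P.K) 0, q.src ∈ ((box (fun κ => (F.P P.K).L ^ (k P i) * ((hi P i κ - lo P i κ + 1).toNat + 3 + 1) - 1) (fun κ => ((F.P P.K).L : ℤ) ^ (k P i) * (lo P i κ - 2))).image
        (fun z => (castSite z : Site (F.P P.K) 0))) → q ∈ W P i)
    -- dag-n12-w6 g7's k-UNIFORM WINDOW-LOCAL (σ)_W producer `N12WindowGaugeLetterUniformSocket.hσW_on_uniform_of_class` (general `Z`, no letter off the window, tolerance `C(d,L)·εreg + m′·ρn`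
    -- INDEPENDENT of `k`): its NUMERICS per instance (level guard `k + c ≤ m + K` with `4d + m′ + 3 < 2L^c`), the class threshold `εreg` positive and Prop. 2-small, the WINDOW `X i` within
    -- walk-distance `D₀ i` of `Ω_{k_i}(Z_i)` (`hXΩ`) with the collar fit `hfit`, the REGION-BOX ROW `hBox` and the two window rows `hWX hfeedsX`
    (c : ∀ P : B12.RunParams, ι P → ℕ) (hkc : ∀ (P : B12.RunParams) (i : ι P), k P i + c P i ≤ (F.P P.K).m + (F.P P.K).K) (hc : ∀ (P : B12.RunParams) (i : ι P), 4 * (F.P P.K).d + (3 * ((F.P P.K).d * (((F.P P.K).L - 1) / 2)) + 5) + 3 < 2 * (F.P P.K).L ^ c P i)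
    (hα3 : ∀ P : B12.RunParams, (143 * (((((F.P P.K).d + 4 : ℕ) : ℝ)) ^ 2 / 4) ^ 2) * ((theta13OfThm1CCMW F 2 j γ ε₀ ε₂₉ B₃ B₃' a₀ a₁).ν.εreg * (F.P P.K).L ^ 2) ≤ 1 / 3)
    (hα2 : ∀ P : B12.RunParams, 2 * ((theta13OfThm1CCMW F 2 j γ ε₀ ε₂₉ B₃ B₃' a₀ a₁).ν.εreg * (F.P P.K).L ^ 2) ≤ 2 * deltaSU (Fin 2) / ((((F.P P.K).d + 4) * (F.P P.K).L : ℕ) : ℝ) ^ 2)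
    (haN : ∀ P : B12.RunParams, (((((F.P P.K).d + 2) * (F.P P.K).L : ℕ) : ℝ) ^ 2 / 4) * (2 * ((theta13OfThm1CCMW F 2 j γ ε₀ ε₂₉ B₃ B₃' a₀ a₁).ν.εreg * (F.P P.K).L ^ 2)) < deltaSU (Fin 2))
    (X : ∀ P : B12.RunParams, ι P → Set (Site (F.P P.K) 0)) (D₀ : ∀ P : B12.RunParams, ι P → ℕ)
    (hXΩ : ∀ (P : B12.RunParams) (i : ι P), ∀ x ∈ X P i, ∃ x₀ ∈ maxDomT (theta13OfThm1CCMW F 2 j γ ε₀ ε₂₉ B₃ B₃' a₀ a₁).ν.M₁ (Z P i) (k P i), ∃ w₀ : List (Letter (F.P P.K).d), w₀.length ≤ D₀ P i ∧ walkEnd x₀ w₀ = x)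
    (hfit : ∀ (P : B12.RunParams) (i : ι P), D₀ P i + 3 * (∑ i' ∈ Finset.range (k P i + 1), ((F.P P.K).d * (((F.P P.K).L ^ i' - 1) / 2) + 1)) + ((3 * ((F.P P.K).d * (((F.P P.K).L - 1) / 2)) + 5) + 5) * (F.P P.K).L ^ k P i +
      (((F.P P.K).d + 4) * (F.P P.K).L + 2) * (∑ l ∈ Finset.Ico 0 (k P i), (F.P P.K).L ^ l) + 4 ≤ (F.P P.K).L ^ (k P i - 1) * (theta13OfThm1CCMW F 2 j γ ε₀ ε₂₉ B₃ B₃' a₀ a₁).ν.M₁)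
    (hBox : ∀ (P : B12.RunParams) (i : ι P), ∀ x ∈ X P i, ∀ w : List (Letter (F.P P.K).d),
      w.length ≤ (∑ i' ∈ Finset.range (k P i + 1), ((F.P P.K).d * (((F.P P.K).L ^ i' - 1) / 2) + 1)) + (3 * ((F.P P.K).d * (((F.P P.K).L - 1) / 2)) + 5) * (F.P P.K).L ^ k P i + (F.P P.K).L ^ k P i →
      ∀ μ : Fin (F.P P.K).d, (⟨B14.Eq22Determines.blockIter (k P i) (walkEnd x w), μ⟩ : PBond (F.P P.K) (k P i)) ∈ (boxBonds (LO P i) (HI P i) : Set (PBond (F.P P.K) (k P i))))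
    (hWX : ∀ (P : B12.RunParams) (i : ι P), ∀ p ∈ W P i, p.src ∈ X P i ∧ p.src.shift p.μ ∈ X P i ∧ p.src.shift p.ν ∈ X P i ∧ (p.src.shift p.μ).shift p.ν ∈ X P i ∧ (p.src.shift p.ν).shift p.μ ∈ X P i)
    (hfeedsX : ∀ (P : B12.RunParams) (i : ι P) (ν' : Fin (F.P P.K).d), ∀ z ∈ box (fun κ => (hi P i κ - lo P i κ + 1).toNat + 3) (fun κ => lo P i κ - 2), ∀ b₀ : PBond (F.P P.K) 0,
      (b₀ ∈ feeds (k P i) (⟨(castSite z : Site (F.P P.K) (k P i)), ⟨0, h0 P⟩⟩ : PBond (F.P P.K) (k P i)) ∨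
        b₀ ∈ feeds (k P i) (⟨((castSite z : Site (F.P P.K) (k P i))).shift ⟨0, h0 P⟩, ν'⟩ : PBond (F.P P.K) (k P i)) ∨
        b₀ ∈ feeds (k P i) (⟨((castSite z : Site (F.P P.K) (k P i))).shift ν', ⟨0, h0 P⟩⟩ : PBond (F.P P.K) (k P i)) ∨
        b₀ ∈ feeds (k P i) (⟨(castSite z : Site (F.P P.K) (k P i)), ν'⟩ : PBond (F.P P.K) (k P i))) → b₀.src ∈ X P i ∧ b₀.tgt ∈ X P i)
    -- the tower-box radius fits the cube side (for the class reading of `hPbox`, dag-n12-c g21's `hPbox_on_of_class`)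
    (hrad : ∀ P : B12.RunParams, (F.P P.K).L + ((F.P P.K).L - 1) / 2 ≤ (theta13OfThm1CCMW F 2 j γ ε₀ ε₂₉ B₃ B₃' a₀ a₁).ν.M₁)
    -- THE CHART HALF, DISPLAYED (LOCATED-FLOOR): its four per-height constants as BINDERS and ONE letter = the ∀-body of `exists_hWD_chartHalf_of_letters'` ∕ `_uniform` at height
    -- `k i` (with `ν Z Λ T lo hi` quantified INSIDE, so that `choose … exists_hWD_chartHalf_of_letters_uniform Kt h0 (hk0 i) (hk i)` discharges it term-for-term BEFORE `ν` is fixed)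
    (C ρ Kτ ρτ : ∀ P : B12.RunParams, ι P → ℝ) (hρ : ∀ (P : B12.RunParams) (i : ι P), 0 < ρ P i) (hKτ : ∀ (P : B12.RunParams) (i : ι P), 0 ≤ Kτ P i) (hρτ : ∀ (P : B12.RunParams) (i : ι P), 0 < ρτ P i)
    (hhalf : ∀ (P : B12.RunParams) (i : ι P),
        ∀ (νu : Node00.Stage7Numerics) (Z Λ : Set (Site (F.P P.K) 0)) (T : Finset (PBond (F.P P.K) (k P i))) (lo hi : Fin (F.P P.K).d → ℤ),
        (∀ κ, ((((hi κ - lo κ + 1).toNat + 3 : ℕ) : ℤ)) ≤ (F.P P.K).sitesPerDir (k P i)) →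
        (∀ (ν' : Fin (F.P P.K).d), ∀ z ∈ box (fun κ => (hi κ - lo κ + 1).toNat + 3) (fun κ => lo κ - 2),
          (castSite z : Site (F.P P.K) (k P i)) ∈ pts (k P i) (maxDomT νu.M₁ Z (k P i)) ∧ (castSite z : Site (F.P P.K) (k P i)).shift ⟨0, h0 P⟩ ∈ pts (k P i) (maxDomT νu.M₁ Z (k P i)) ∧
            (castSite z : Site (F.P P.K) (k P i)).shift ν' ∈ pts (k P i) (maxDomT νu.M₁ Z (k P i))) →
        ∀ (ext : GaugeField (F.P P.K) (k P i) SU2 → GaugeField (F.P P.K) (k P i) SU2) (Vk : GaugeField (F.P P.K) (k P i) SU2) ⦃R 𝓐₀ : ℝ⦄, 0 < R → 0 ≤ 𝓐₀ →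
        ∀ (U₀ : GaugeField (F.P P.K) 0 SU2) (Xf : GaugeSlice (pts (k P i) Λ) T E3 → PBond (F.P P.K) 0 → lieSU (Fin 2)),
        IsMinimizer (Node00.avOfRecord F 2 P.K) (Node00.regMSCoPOfRecord F 2 νu P.K (k P i) (maxDomT νu.M₁ Z)) (Bj νu.M₁ Z (k P i))
          (avgFamily (Node00.avOfRecord F 2 P.K) (qsstarGIter0 (k P i) (ext Vk))) U₀ →
        SmallBelow (Node00.avOfRecord F 2 P.K) (k P i) U₀ →
        ∀ ⦃εP : ℝ⦄, 0 ≤ εP →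
        (∀ p : Plaq (F.P P.K) 0, ((⟨p.src, p.μ⟩ : PBond (F.P P.K) 0) ∈ {b : PBond (F.P P.K) 0 | b.src ∈ maxDomT νu.M₁ Z 1} ∨
            (⟨p.src.shift p.μ, p.ν⟩ : PBond (F.P P.K) 0) ∈ {b : PBond (F.P P.K) 0 | b.src ∈ maxDomT νu.M₁ Z 1} ∨
            (⟨p.src.shift p.ν, p.μ⟩ : PBond (F.P P.K) 0) ∈ {b : PBond (F.P P.K) 0 | b.src ∈ maxDomT νu.M₁ Z 1} ∨
            (⟨p.src, p.ν⟩ : PBond (F.P P.K) 0) ∈ {b : PBond (F.P P.K) 0 | b.src ∈ maxDomT νu.M₁ Z 1}) →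
          ‖((GaugeField.plaqHol U₀ p : SU2) : Matrix (Fin 2) (Fin 2) ℂ) - 1‖ ≤ εP) →
        ∀ (H : (Fin (constrCard (Bj νu.M₁ Z (k P i)) (k P i)) → lieSU (Fin 2)) → PBond (F.P P.K) 0 → lieSU (Fin 2)) ⦃B : ℝ⦄, 0 ≤ B →
        (∀ v, fderiv ℝ (msChart F 2 P.K (k P i) (Bj νu.M₁ Z (k P i)) (avgFamily (avOfRecord F 2 P.K) (qsstarGIter0 (k P i) (ext Vk))) U₀) 0 (H v) = v) →
        (∀ v, Real.sqrt (∑ b, ‖H v b‖ ^ 2) ≤ B * ‖v‖) →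
        ∀ ⦃M₂ : ℝ⦄, 0 ≤ M₂ → (∀ w, ‖fderiv ℝ (fderiv ℝ (msChart F 2 P.K (k P i) (Bj νu.M₁ Z (k P i)) (avgFamily (avOfRecord F 2 P.K) (qsstarGIter0 (k P i) (ext Vk))) U₀)) 0 w w‖ ≤ M₂ * ‖w‖ ^ 2) →
        Xf 0 = 0 → ContDiffAt ℝ 2 Xf 0 →
        (∀ᶠ Y in 𝓝 (0 : GaugeSlice (pts (k P i) Λ) T E3),
          IsMinimizer (Node00.avOfRecord F 2 P.K) (Node00.regMSCoPOfRecord F 2 νu P.K (k P i) (maxDomT νu.M₁ Z)) (Bj νu.M₁ Z (k P i))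
            (avgFamily (Node00.avOfRecord F 2 P.K) (qsstarGIter0 (k P i) (expMul su2Chart (ιA (pts (k P i) Λ) T Y) (ext Vk)))) (expChart U₀ (Xf Y))) →
        (∀ (X : GaugeSlice (pts (k P i) Λ) T E3) (b : PBond (F.P P.K) 0),
          ‖((fderiv ℝ Xf 0 X b : lieSU (Fin 2)) : Matrix (Fin 2) (Fin 2) ℂ)‖ ≤ 8 * 𝓐₀ / R * ‖X‖ ∧ ‖fderiv ℝ Xf 0 X b‖ ≤ 12 * 𝓐₀ / R * ‖X‖) →
        (∀ (X : GaugeSlice (pts (k P i) Λ) T E3) (b : PBond (F.P P.K) 0), b.src ∉ maxDomT νu.M₁ Z 1 → fderiv ℝ Xf 0 X b = 0) →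
        ∀ (W : Finset (Plaq (F.P P.K) 0)),
        (∀ q : Plaq (F.P P.K) 0, q.src ∈ ((box (fun κ => (F.P P.K).L ^ (k P i) * ((hi κ - lo κ + 1).toNat + 3 + 1) - 1) (fun κ => ((F.P P.K).L : ℤ) ^ (k P i) * (lo κ - 2))).image
            (fun z => (castSite z : Site (F.P P.K) 0))) → q ∈ W) →
        ∀ ⦃δW : ℝ⦄, 0 < δW → δW < (ρ P i) → δW < (ρτ P i) →
        (∀ (ν' : Fin (F.P P.K).d), ∀ z ∈ box (fun κ => (hi κ - lo κ + 1).toNat + 3) (fun κ => lo κ - 2), ∀ b₀ : PBond (F.P P.K) 0,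
          (b₀ ∈ feeds (k P i) (⟨(castSite z : Site (F.P P.K) (k P i)), ⟨0, h0 P⟩⟩ : PBond (F.P P.K) (k P i)) ∨ b₀ ∈ feeds (k P i) (⟨((castSite z : Site (F.P P.K) (k P i))).shift ⟨0, h0 P⟩, ν'⟩ : PBond (F.P P.K) (k P i))
          ∨ b₀ ∈ feeds (k P i) (⟨((castSite z : Site (F.P P.K) (k P i))).shift ν', ⟨0, h0 P⟩⟩ : PBond (F.P P.K) (k P i)) ∨ b₀ ∈ feeds (k P i) (⟨(castSite z : Site (F.P P.K) (k P i)), ν'⟩ : PBond (F.P P.K) (k P i))) →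
          ‖((U₀ b₀ : SU2) : Matrix (Fin 2) (Fin 2) ℂ) - 1‖ ≤ δW) →
        ∃ (Ψ₂ : (PBond (F.P P.K) 0 → lieSU (Fin 2)) →L[ℝ] (PBond (F.P P.K) 0 → lieSU (Fin 2)) →L[ℝ] (Fin (constrCard (Bj νu.M₁ Z (k P i)) (k P i)) → lieSU (Fin 2)))
          (lam : (Fin (constrCard (Bj νu.M₁ Z (k P i)) (k P i)) → lieSU (Fin 2)) →L[ℝ] ℝ)
          (p : Seminorm ℝ (PBond (F.P P.K) 0 → lieSU (Fin 2))),
          HasFDerivAt (fun Y => fderiv ℝ (msChart F 2 P.K (k P i) (Bj νu.M₁ Z (k P i)) (avgFamily (avOfRecord F 2 P.K) (qsstarGIter0 (k P i) (ext Vk))) U₀) Y) Ψ₂ 0 ∧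
          (∀ᶠ Y in 𝓝 (0 : PBond (F.P P.K) 0 → lieSU (Fin 2)), DifferentiableAt ℝ (msChart F 2 P.K (k P i) (Bj νu.M₁ Z (k P i)) (avgFamily (avOfRecord F 2 P.K) (qsstarGIter0 (k P i) (ext Vk))) U₀) Y) ∧
          fderiv ℝ (fun Y : PBond (F.P P.K) 0 → lieSU (Fin 2) => wilsonAction4 (expChart U₀ Y)) 0 = lam.comp (fderiv ℝ (msChart F 2 P.K (k P i) (Bj νu.M₁ Z (k P i)) (avgFamily (avOfRecord F 2 P.K) (qsstarGIter0 (k P i) (ext Vk))) U₀) 0) ∧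
          (∀ Y : PBond (F.P P.K) 0 → lieSU (Fin 2), ∑ b, ‖(Y b : Matrix (Fin 2) (Fin 2) ℂ)‖ ^ 2 ≤ p Y ^ 2) ∧
          ∀ X : GaugeSlice (pts (k P i) Λ) T E3,
            lam (Ψ₂ (fderiv ℝ Xf 0 X) (fderiv ℝ Xf 0 X))
                ≤ (2 * (((F.P P.K).d : ℝ) - 1) * εP * Real.sqrt (Fintype.card (PBond (F.P P.K) 0)) * B * M₂) * p (fderiv ℝ Xf 0 X) ^ 2 ∧
            p (fderiv ℝ Xf 0 X) ≤ (12 * 𝓐₀ / R * Real.sqrt (Nat.card {b : PBond (F.P P.K) 0 // b.src ∈ maxDomT νu.M₁ Z 1})) * ‖X‖ ∧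
            (((F.P P.K).L : ℝ) ^ (F.P P.K).d) ^ (k P i) / ((((F.P P.K).L : ℝ)) ^ 2 * ((F.P P.K).L : ℝ) ^ 2) ^ (k P i) / 2 * (∑ z ∈ box (fun κ => (hi κ - lo κ + 1).toNat + 3) (fun κ => lo κ - 2), ∑ μ : Fin (F.P P.K).d, ∑ a : Fin 3, curl (fun b => ιA (pts (k P i) Λ) T X (⟨castSite b.1, b.2⟩ : PBond (F.P P.K) (k P i)) a) z ⟨0, h0 P⟩ μ ^ 2)
                - (((F.P P.K).L : ℝ) ^ (F.P P.K).d) ^ (k P i) / ((((F.P P.K).L : ℝ)) ^ 2 * ((F.P P.K).L : ℝ) ^ 2) ^ (k P i) * (8 * (((F.P P.K).d : ℝ) + 1) * (2 * ((Kτ P i) + 1) * δW) + 8 * ((F.P P.K).d : ℝ) * (((box (fun κ => (hi κ - lo κ + 1).toNat + 3) (fun κ => lo κ - 2)).image (fun z => (castSite z : Site (F.P P.K) (k P i)))).card : ℝ) * ((C P i) * δW * (12 * 𝓐₀ / R * Real.sqrt (Nat.card {b : PBond (F.P P.K) 0 // b.src ∈ maxDomT νu.M₁ Z 1}))) ^ 2)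 * ‖X‖ ^ 2
              ≤ ((Fintype.card (Fin 2) : ℝ)⁻¹ • ∑ p ∈ W, (innerSL ℝ (E := lieSU (Fin 2))).bilinearComp
                (ContinuousLinearMap.proj (R := ℝ) (φ := fun _ : PBond (F.P P.K) 0 => lieSU (Fin 2)) (⟨p.src, p.μ⟩ : PBond (F.P P.K) 0) + ContinuousLinearMap.proj (R := ℝ) (φ := fun _ : PBond (F.P P.K) 0 => lieSU (Fin 2)) (⟨p.src.shift p.μ, p.ν⟩ : PBond (F.P P.K) 0)
                  - ContinuousLinearMap.proj (R := ℝ) (φ := fun _ : PBond (F.P P.K) 0 => lieSU (Fin 2)) (⟨p.src.shift p.ν, p.μ⟩ : PBond (F.P P.K) 0) - ContinuousLinearMap.proj (R := ℝ) (φ := fun _ : PBond (F.P P.K) 0 => lieSU (Fin 2)) (⟨p.src, p.ν⟩ : PBond (F.P P.K) 0) : (PBond (F.P P.K) 0 → lieSU (Fin 2)) →L[ℝ] lieSU (Fin 2))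
                (ContinuousLinearMap.proj (R := ℝ) (φ := fun _ : PBond (F.P P.K) 0 => lieSU (Fin 2)) (⟨p.src, p.μ⟩ : PBond (F.P P.K) 0) + ContinuousLinearMap.proj (R := ℝ) (φ := fun _ : PBond (F.P P.K) 0 => lieSU (Fin 2)) (⟨p.src.shift p.μ, p.ν⟩ : PBond (F.P P.K) 0)
                  - ContinuousLinearMap.proj (R := ℝ) (φ := fun _ : PBond (F.P P.K) 0 => lieSU (Fin 2)) (⟨p.src.shift p.ν, p.μ⟩ : PBond (F.P P.K) 0) - ContinuousLinearMap.proj (R := ℝ) (φ := fun _ : PBond (F.P P.K) 0 => lieSU (Fin 2)) (⟨p.src, p.ν⟩ : PBond (F.P P.K) 0) : (PBond (F.P P.K) 0 → lieSU (Fin 2)) →L[ℝ] lieSU (Fin 2))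
                : (PBond (F.P P.K) 0 → lieSU (Fin 2)) →L[ℝ] (PBond (F.P P.K) 0 → lieSU (Fin 2)) →L[ℝ] ℝ) (fderiv ℝ Xf 0 X) (fderiv ℝ Xf 0 X))
    -- THE (P4)′ PRODUCER's TWO CONSTANTS PER INSTANCE, AS BINDERS (its `ε` per height, its `B` per `(M₁, Z)` — never after `εreg`∕`ρn`), and its LETTER `hHB` displayed: the ∀-body of
    -- dag-n12-w6's `N12DirectSurjHsurj.exists_rightInverse_letter` at `(2, Kt, k i, ν.M₁, Z i; εH i, B i)` (inhabited by p664681 — §2); the chart-curvature constant (P5) `M₂`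
    (εH B M₂ : ∀ P : B12.RunParams, ι P → ℝ) (hB0 : ∀ (P : B12.RunParams) (i : ι P), 0 ≤ B P i) (hM₂0 : ∀ (P : B12.RunParams) (i : ι P), 0 ≤ M₂ P i)
    (hHB : ∀ (P : B12.RunParams) (i : ι P) (Wd : MSField (F.P P.K) SU2) (U₀ : GaugeField (F.P P.K) 0 SU2),
      AgreeOn (Bj (theta13OfThm1CCMW F 2 j γ ε₀ ε₂₉ B₃ B₃' a₀ a₁).ν.M₁ (Z P i) (k P i)) (avgFamily (Node00.avOfRecord F 2 P.K) U₀) Wd → Node00.SmallBelow (Node00.avOfRecord F 2 P.K) (k P i) U₀ →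
      (∀ (l : ℕ), 1 ≤ l → l ≤ k P i → ∀ y : Site (F.P P.K) l, embIter l y ∈ maxDomT (theta13OfThm1CCMW F 2 j γ ε₀ ε₂₉ B₃ B₃' a₀ a₁).ν.M₁ (Z P i) l →
        PlaqSmallOn (boxPlaqs (fun κ => lift (F.P P.K) (embIter l y) κ - ((((F.P P.K).L ^ l : ℕ) : ℤ) + ((((F.P P.K).L ^ l - 1) / 2 : ℕ) : ℤ)))
          (fun κ => lift (F.P P.K) (embIter l y) κ + ((((F.P P.K).L ^ l : ℕ) : ℤ) + ((((F.P P.K).L ^ l - 1) / 2 : ℕ) : ℤ))) : Set (Plaq (F.P P.K) 0)) (εH P i) U₀) →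
      ∃ H : (Fin (constrCard (Bj (theta13OfThm1CCMW F 2 j γ ε₀ ε₂₉ B₃ B₃' a₀ a₁).ν.M₁ (Z P i) (k P i)) (k P i)) → lieSU (Fin 2)) → PBond (F.P P.K) 0 → lieSU (Fin 2),
        (∀ v, fderiv ℝ (msChart F 2 P.K (k P i) (Bj (theta13OfThm1CCMW F 2 j γ ε₀ ε₂₉ B₃ B₃' a₀ a₁).ν.M₁ (Z P i) (k P i)) Wd U₀) 0 (H v) = v) ∧ ∀ v, Real.sqrt (∑ b, ‖H v b‖ ^ 2) ≤ B P i * ‖v‖)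
    -- DISPLAYED per guarded base field ∕ minimiser: the small-below letter and the chart-curvature letter (P5) — the (P4)′ socket is DISCHARGED by `hHB` ∘ (fibre clause, `hsb`, `hPbox`)
    (hsb : ∀ (P : B12.RunParams) (i : ι P) (Vk : GaugeField (F.P P.K) (k P i) SU2), PlaqSmallOn (plaqsInside (pts (k P i) (Z P i ∩ (Λ P i)ᶜ))) (eR P i) Vk →
      (∀ b ∈ (boxBonds (LO P i) (HI P i) : Set (PBond (F.P P.K) (k P i))), dist1 (ext P i Vk b) ≤ ρn P i) →
      ∀ U₀ : GaugeField (F.P P.K) 0 SU2,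
        IsMinimizer (Node00.avOfRecord F 2 P.K) (Node00.regMSCoPOfRecord F 2 (theta13OfThm1CCMW F 2 j γ ε₀ ε₂₉ B₃ B₃' a₀ a₁).ν P.K (k P i) (maxDomT (theta13OfThm1CCMW F 2 j γ ε₀ ε₂₉ B₃ B₃' a₀ a₁).ν.M₁ (Z P i))) (Bj (theta13OfThm1CCMW F 2 j γ ε₀ ε₂₉ B₃ B₃' a₀ a₁).ν.M₁ (Z P i) (k P i))
          (avgFamily (Node00.avOfRecord F 2 P.K) (qsstarGIter0 (k P i) (ext P i Vk))) U₀ →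
        Node00.SmallBelow (Node00.avOfRecord F 2 P.K) (k P i) U₀)
    (hM₂ : ∀ (P : B12.RunParams) (i : ι P) (Vk : GaugeField (F.P P.K) (k P i) SU2), PlaqSmallOn (plaqsInside (pts (k P i) (Z P i ∩ (Λ P i)ᶜ))) (eR P i) Vk →
      (∀ b ∈ (boxBonds (LO P i) (HI P i) : Set (PBond (F.P P.K) (k P i))), dist1 (ext P i Vk b) ≤ ρn P i) →
      ∀ U₀ : GaugeField (F.P P.K) 0 SU2,
        IsMinimizer (Node00.avOfRecord F 2 P.K) (Node00.regMSCoPOfRecord F 2 (theta13OfThm1CCMW F 2 j γ ε₀ ε₂₉ B₃ B₃' a₀ a₁).ν P.K (k P i) (maxDomT (theta13OfThm1CCMW F 2 j γ ε₀ ε₂₉ B₃ B₃' a₀ a₁).ν.M₁ (Z P i))) (Bj (theta13OfThm1CCMW F 2 j γ ε₀ ε₂₉ B₃ B₃' a₀ a₁).ν.M₁ (Z P i) (k P i))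
          (avgFamily (Node00.avOfRecord F 2 P.K) (qsstarGIter0 (k P i) (ext P i Vk))) U₀ →
        ∀ w, ‖fderiv ℝ (fderiv ℝ (msChart F 2 P.K (k P i) (Bj (theta13OfThm1CCMW F 2 j γ ε₀ ε₂₉ B₃ B₃' a₀ a₁).ν.M₁ (Z P i) (k P i)) (avgFamily (Node00.avOfRecord F 2 P.K) (qsstarGIter0 (k P i) (ext P i Vk))) U₀)) 0 w w‖ ≤ M₂ P i * ‖w‖ ^ 2)
    -- numerics: the positivity constant fits (`γ₀ := 1∕2`: the chart half's level factor `((L^d)^k∕(L²·L²)^k)∕2` at `d = 4`)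
    (hγle : ∀ (P : B12.RunParams) (i : ι P), γ₈ P / (M P i) ^ 5 ≤ 1 / 2 / (2 * (3 * (Kb P i : ℝ) ^ 2 + 2 * (Kb P i : ℝ) ^ 4)))
    -- the geometric letter: every fine site whose k-block label lies in the box `[lo − 1, hi + 1]` lies in `Ω₁(Z)` (print: `Λ` deep inside `Z`); dag-n12-c's `far_letter_of_box` turns it into the bond letter `hfar`
    (hZ1 : ∀ (P : B12.RunParams) (i : ι P) (y : Site (F.P P.K) 0), B14.Eq22Determines.blockIter (k P i) y ∈ (castSite '' Set.Icc (lo P i - 1) (hi P i + 1) : Set (Site (F.P P.K) (k P i))) → y ∈ maxDomT (theta13OfThm1CCMW F 2 j γ ε₀ ε₂₉ B₃ B₃' a₀ a₁).ν.M₁ (Z P i) 1)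
    (hZblk : ∀ (P : B12.RunParams) (i : ι P), IsBlockUnion (k P i) (Z P i))
    (hdiv : ∀ (P : B12.RunParams) (i : ι P), side (F.P P.K).L (theta13OfThm1CCMW F 2 j γ ε₀ ε₂₉ B₃ B₃' a₀ a₁).ν.M₁ (k P i) ∣ (F.P P.K).sitesPerDir 0)
    {cE cA : B12.RunParams → ℝ} (hcE0 : ∀ P : B12.RunParams, 0 ≤ cE P) (hcE : ∀ (P : B12.RunParams) (i : ι P), 12 * ((F.P P.K).d : ℝ) * ((n P i : ℝ) + 2) ^ 2 ≤ cE P)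
    (heRa : ∀ (P : B12.RunParams) (i : ι P), (cE P + 1) * eR P i ≤ a₁ ∧ B₃ * ((cE P + 1) * eR P i) ≤ (theta13OfThm1CCMW F 2 j γ ε₀ ε₂₉ B₃ B₃' a₀ a₁).ν.εreg)
    (hcA : ∀ P : B12.RunParams, 1 / 2 * (B₃ * (cE P + 1) * (F.P P.K).eta 1 ^ 2) ^ 2 * (Fintype.card (Plaq (F.P P.K) 0) : ℝ) ≤ cA P)
    (hcJ' : ∀ (P : B12.RunParams) (i : ι P), 2 * cA P * eR P i / R P i + 4 * ((Fintype.card (Plaq (F.P P.K) 0) : ℝ) * (1 + 8 * 𝓐₀ P i ^ 4)) / (R P i * eR P i) ≤ cJ P)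
    -- THE EXPLICIT-THRESHOLD FRAME (no `∃ δ₀`): tolerances below `Θ i := min (min (ρ i) (ρτ i) ∕ 2) (min 1 (rhs_i ∕ (max S_i 0 + 1)))`, every symbol a binder or a cardinality
    (h15 : VariationalThm1RegSepCoP7M F 2 B₃ a₀ a₁) (hj : 1 ≤ j) :
    ∀ δ : ∀ P : B12.RunParams, ι P → ℝ, (∀ P i, 0 < δ P i) →
      -- the endpoint's EXPLICIT THRESHOLD per run (every quantity a displayed binder or a count of the run's instance — no `∃ δ₀`), then its TOLERANCE rows at `δ P i`
      (∀ (P : B12.RunParams) (i : ι P), δ P i ≤ min (min (min (ρ P i) (ρτ P i) / 2)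
        (min 1 (1 / 2 / (2 * (3 * (Kb P i : ℝ) ^ 2 + 2 * (Kb P i : ℝ) ^ 4)) /
          (max ((32 * (((F.P P.K).d : ℝ) - 1) + 8 * (((F.P P.K).d : ℝ) - 1) + (2 * (((F.P P.K).d : ℝ) - 1) * Real.sqrt (Fintype.card (PBond (F.P P.K) 0)) * B P i * M₂ P i)) * (12 * 𝓐₀ P i / R P i * Real.sqrt (Nat.card {b : PBond (F.P P.K) 0 // b.src ∈ maxDomT (theta13OfThm1CCMW F 2 j γ ε₀ ε₂₉ B₃ B₃' a₀ a₁).ν.M₁ (Z P i) 1})) ^ 2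
            + (8 * (((F.P P.K).d : ℝ) + 1) * (2 * (Kτ P i + 1)) + 8 * ((F.P P.K).d : ℝ) * (((box (fun κ => (hi P i κ - lo P i κ + 1).toNat + 3) (fun κ => lo P i κ - 2)).image (fun z => (castSite z : Site (F.P P.K) (k P i)))).card : ℝ) * (C P i * (12 * 𝓐₀ P i / R P i * Real.sqrt (Nat.card {b : PBond (F.P P.K) 0 // b.src ∈ maxDomT (theta13OfThm1CCMW F 2 j γ ε₀ ε₂₉ B₃ B₃' a₀ a₁).ν.M₁ (Z P i) 1}))) ^ 2)) 0 + 1)))) (εH P i)) →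
      ∀ (hfloor : ∀ (P : B12.RunParams) (i : ι P), ((((4 * (F.P P.K).d + (3 * ((F.P P.K).d * (((F.P P.K).L - 1) / 2)) + 5) + 3 : ℕ) : ℝ)) ^ 2 * ((F.P P.K).L : ℝ) ^ 2 / 4 + ((3 * ((F.P P.K).d * (((F.P P.K).L - 1) / 2)) + 5 : ℕ) : ℝ) * (24 * (((((F.P P.K).d + 2) * (F.P P.K).L : ℕ) : ℝ) ^ 2 / 4))) * (theta13OfThm1CCMW F 2 j γ ε₀ ε₂₉ B₃ B₃' a₀ a₁).ν.εreg + ((3 * ((F.P P.K).d * (((F.P P.K).L - 1) / 2)) + 5 : ℕ) : ℝ) * ρn P i ≤ δ P i),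
      ∃ γ₁₂ : ℝ, 0 < γ₁₂ ∧ ∃ lamW : ResidW F 2, ∀ P : B12.RunParams, lamW.kSel P < P.K → Step.InInterval γ₁₂ P.K (gOfRecord₁₃ F 2 (theta13OfThm1CCMW F 2 j γ ε₀ ε₂₉ B₃ B₃' a₀ a₁) P) →
        B15Leaf (WOfRecord₁₃ F 2 (theta13OfThm1CCMW F 2 j γ ε₀ ε₂₉ B₃ B₃' a₀ a₁) lamW P) := by
  -- `2 ≤ M₁ = L^j` at the window-edition witness (`1 ≤ j`, `1 < L`); `εreg = a₀` (`rfl`)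
  have h2 : 2 ≤ F.L ^ j :=
    calc 2 ≤ F.L := F.hL.2
      _ = F.L ^ 1 := (pow_one _).symm
      _ ≤ F.L ^ j := Nat.pow_le_pow_right (Nat.zero_lt_of_lt F.hL.2) hj
  intro δtol hδtol hδtol_le hfloor
  choose areg hapos hrow using fun P : B12.RunParams =>
    exists_domain_prop1Printed_lfVarOn_std_su2_box_intrinsic_analytic_atZSeqCoPRecord_ofThm1TorusClass_ofMinimiserFamily_ofClassLetters_ofWindowGaugeUniform_ofChartHalfLetter_ofRightInverseLetter_explicit (F := F) (theta13OfThm1CCMW F 2 j γ ε₀ ε₂₉ B₃ B₃' a₀ a₁).ν P.K (hd3 P) (h0 P)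
      (Z := Z P) (Λ := Λ P) (k := k P) (M := M P) (hk0 := hk0 P) (hk1 := hk1 P) (eR := eR P) (heR := heR P) (T := T P) (lo := lo P) (hi := hi P) (n := n P) (hn := hn P)
      (hN := hN P) (hbox := hbox P) (hZ := hZ P) (hTG0 := hTG0 P) (hN5 := hN5 P) (K := Kb P) (hK1 := hK1 P) (hKn := hKn P) (ext := ext P) (hext := hext P) (hlohi := hlohi P)
      (LO := LO P) (HI := HI P) (hLO := hLO P) (hHI := hHI P) (n' := n' P) (hn' := hn' P) (hn'N := hn'N P) (hR' := hR' P) (ρn := ρn P) (hρn := hρn P) (hγ := hγ P)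
      (hcJ := hcJ P) (hbx := hbx P) (hbxM := hbxM P) (hM := hM P) (hR := hR P) (h𝓐₀ := h𝓐₀ P) (hMin := hMin P) (hΩw := hΩw P) (W := W P) (hWbox := hWbox P) (c := c P)
      (hkc := hkc P) (hc := hc P) (hεreg := ha₀) (hα3 := hα3 P) (hα2 := hα2 P) (haN := haN P) (X := X P) (D₀ := D₀ P) (hXΩ := hXΩ P) (hfit := hfit P) (hBox := hBox P)
      (hWX := hWX P) (hfeedsX := hfeedsX P) (hrad := hrad P) (C := C P) (ρ := ρ P) (Kτ := Kτ P) (ρτ := ρτ P) (hρ := hρ P) (hKτ := hKτ P) (hρτ := hρτ P) (hhalf := hhalf P)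
      (εH := εH P) (B := B P) (M₂ := M₂ P) (hB0 := hB0 P) (hM₂0 := hM₂0 P) (hHB := hHB P) (hsb := hsb P) (hM₂ := hM₂ P) (hγle := hγle P) (hfar := fun i b hb => far_letter_of_box (hbox P i) (hZ1 P i) b hb)
      (hZblk := hZblk P) (hM2 := h2) (hdiv := hdiv P) (hcE0 := hcE0 P) (hcE := hcE P) (hB₃ := hB) (heRa := heRa P) (ha₀ := le_of_eq rfl) (hcA := hcA P) (h15T := thm1TorusClass_of_variationalThm1RegSepCoP7M (theta13OfThm1CCMW F 2 j γ ε₀ ε₂₉ B₃ B₃' a₀ a₁).ν P.K h15)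
      (hcJ' := hcJ' P)
      (δtol P) (hδtol P) (hδtol_le P) (hfloor P)
  -- 12Zᴳ-W §2 at the LF-pinned base layer, its Prop-1 row fed
  exact exists_gamma_residW_b15Leaf_window_theta13OfThm1CCMW_topLevel_pinnedΛΩχZ_of_massLive
    { lam with LF := fun P => lfVarOn su2Chart fun i => InstOn.std (Node00.bgMSCoPOfRecord F 2 (theta13OfThm1CCMW F 2 j γ ε₀ ε₂₉ B₃ B₃' a₀ a₁).ν P.K (k P i) (maxDomT (theta13OfThm1CCMW F 2 j γ ε₀ ε₂₉ B₃ B₃' a₀ a₁).ν.M₁ (Z P i))) (theta13OfThm1CCMW F 2 j γ ε₀ ε₂₉ B₃ B₃' a₀ a₁).ν.M₁ (Z P i) (Λ P i) (k P i) (M P i) (areg P i) (anExt (pts (k P i) (Λ P i)) (T P i) (fun177std (Node00.bgMSCoPOfRecord F 2 (theta13OfThm1CCMW F 2 j γ ε₀ ε₂₉ B₃ B₃' a₀ a₁).ν P.K (k P i) (maxDomT (theta13OfThm1CCMW F 2 j γ ε₀ ε₂₉ B₃ B₃' a₀ a₁).ν.M₁ (Z P i))) (theta13OfThm1CCMW F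 2 j γ ε₀ ε₂₉ B₃ B₃' a₀ a₁).ν.M₁ (Z P i) (k P i)) (ext P i) (min (1 / 2) (min (R P i / 8) (γ₈ P / (M P i) ^ 5 * (R P i / 2) ^ 2 / (48 * (4 * ((Fintype.card (Plaq (F.P P.K) 0) : ℝ) * (1 + 8 * 𝓐₀ P i ^ 4)) / R P i + 1)))))) }
    σ s Nm p₁ hγ₀ hγh hB hB' ha₀ ha₁ hbox' hβ' hγe D hD hmassLive (fun P _ _ => hrow P) hNN hNk hβ0 hβ hL₀ hL₀L hOB hδ hC hβhist hMl hΛ L91h L95 L91 L97 L80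

end WindowRoadPinLF

end Summit.QuantumFields.YangMills.BalabanUVNodes.N12AtTheta13OfThm1CCMWGenericDoorWindowGuardPinLFWindowDirectOfClassWindowUniformExplicit

end
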